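import Summits.BirchSwinnertonDyer.Rank1Residual.X11b.Three.MultiplicativeNodePresentation
import Summits.BirchSwinnertonDyer.Rank1Residual.X11b.Three.JetchevKummerLink
import Literature.NumberTheory.EllipticCurves.QuadraticTwistPadicReduction
import HarnessLib

/-!
# X11b at `p = 3` (team N8/O2), JET3-KUMMER (α), instantiation fact (iii)(a′): from the CLASS
# PREDICATE `W.HasSplitMultiplicativeReductionAtPrime p` of `E/ℚ` to the node presentation over
# every unramified layer `L ⊇ ℚ_p`

HONEST FRAMING (cell `b2b-bsdres`, run/shared/lean/b2b/bsd-rank1-residual/, verbatim in every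
file): the goal of the cell is to DELETE the COMBINATION-SHAPED residual classes of the
Birch–Swinnerton-Dyer formula for ALL analytic-rank `≤ 1` elliptic curves over `ℚ` — "full BSD
formula for every rank `≤ 1` curve in class `C`" assembled STRICTLY from published theorems — so
that the rank-`≤ 1` remainder becomes exactly the CONSTRUCTION-SHAPED classes, which are TYPED
(missing-input `Prop`s), NOT attempted. This is not "finishing BSD". Team N8/O2 = `x11b3`, seat
`b2b-bsdres-x11b3-p8` (gen 3), LEAD DEAL #6 rows R6-9 / A6.2 (2) / R6-14 (help-wanted), S15 (iii)(a′):
companion of `MultiplicativeNodePresentation` (p255042). THEOREMS ONLY: no definition, no named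
fact, no `sorry`; nothing is booked; `JET@p|N` NOT discharged.

## What

The class records of X11b at `3` speak of `E/ℚ` through the tree predicate
`WeierstrassCurve.HasSplitMultiplicativeReductionAtPrime W p` (Mathlib's
`HasSplitMultiplicativeReduction ℤ_[p]` of the CHOSEN minimal model `(W ⊗ ℚ_p).minimal ℤ_[p]`),
while p1's `JetchevKummerAtP` / `JetchevKummerLink` §4 dictionary and p4's node theorems speak of
the global minimal equation itself, `X = W ⊗ ℚ_p` over `F = ℚ_p`, base-changed to a layer
`L ⊇ ℚ_p` with valuation ring `R`, `ℤ_p → R` local. This file is the glue: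

* `hasMultiplicativeReductionAtPrime_iff_baseChange_padic`,
  `hasSplitMultiplicativeReductionAtPrime_iff_baseChange_padic`: for a global minimal `W`, the
  tree predicates at `p` ↔ Mathlib's classes for `W ⊗ ℚ_p` itself over `ℤ_[p]` (two `ℤ_p`-minimal
  equations of the same curve have the same reduction type — tree
  `has[Split]MultiplicativeReduction[AtPrime]_iff_of_[isMinimal_of_]…eq_smul`, p1's instance
  `isMinimal_baseChange_padic`); `_self` respellings for `(W ⊗ ℚ_p) ⊗ ℚ_p`;
* `has[Split]MultiplicativeReduction_baseChange_padic`: then `(W ⊗ ℚ_p) ⊗ L` has (split)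
  multiplicative reduction over `R` for every `L ⊇ ℚ_p` with `ℤ_p → R` local (p4's
  `hasMultiplicativeReduction_baseChange`, p255042's `hasSplitMultiplicativeReduction_baseChange`);
* `exists_map_residue_eq_singularModel_padic` (split: p4's `hW`, `hα` over the finite residue
  field) and `exists_map_map_residue_eq_singularModel_padic` (multiplicative: the `k'`-form for
  the non-split node, S15 (ii));
* `exists_baseChange_eq_add_pow_smul_padic_of_h1ker`: the Prop. 4.1-at-`v` end form for `E/ℚ`
  with split multiplicative reduction at `p`, over such a layer, modulo p1's inputs (a), (b), the
  cocycle, the unramified-layer data `hR`/`hφ`/`hn`/`hcard`/`hfrob` and the ONE stub `h1ker`.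

References (locators only; no new fact): [cite: SilvermanAEC2009, VII.1 Prop. 1.3(b), VII.5
Prop. 5.1(b) and Definition (PDF pp. 165–166, 174), VIII.8 (global minimal equations)]
[cite: Jetchev2008, Prop. 4.1 (p. 819)] [cite: MilneADT2006, Ch. I Prop. 3.8].

## Design

No definitions; `noncomputable section`; `open scoped Classical`; `L : Type` (the universe of
`ℚ_[p]`, as p1's dictionary requires `F` and `L` in one universe). Axioms: `propext`,
`Classical.choice`, `Quot.sound`.
-/

noncomputable section

open scoped Classical

namespace Summit.BirchSwinnertonDyer.Rank1Residual.X11b.Three.JetchevKummer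

open WeierstrassCurve Literature.NumberTheory.EllipticCurves

variable (W : WeierstrassCurve ℚ) [W.IsElliptic] [W.IsGloballyMinimal] (p : ℕ) [Fact p.Prime]

/-! ### §1 The class predicates on the global minimal equation `W ⊗ ℚ_p` -/

/-- **Multiplicative reduction at `p`, read on the global minimal equation.** For a global
minimal `W/ℚ`: `W.HasMultiplicativeReductionAtPrime p` (Mathlib's chosen `ℤ_p`-minimal model of
`W ⊗ ℚ_p`) iff `W ⊗ ℚ_p` itself — `ℤ_p`-minimal by p1's `isMinimal_baseChange_padic` — has
multiplicative reduction over `ℤ_[p]` (two minimal equations differ by a change of variables with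
`v(u) = 0`). [cite: SilvermanAEC2009, VII.1 Prop. 1.3(b) and VII.5 Prop. 5.1(b) (PDF pp. 165, 174)] -/
theorem hasMultiplicativeReductionAtPrime_iff_baseChange_padic :
    W.HasMultiplicativeReductionAtPrime p ↔
      (W.baseChange ℚ_[p]).HasMultiplicativeReduction ℤ_[p] :=
  hasMultiplicativeReduction_iff_of_isMinimal_of_eq_smul ℤ_[p]
    (W₂ := (W.baseChange ℚ_[p]).minimal ℤ_[p]) (W₁ := W.baseChange ℚ_[p])
    (D := ((W.baseChange ℚ_[p]).exists_isMinimal ℤ_[p]).choose) rfl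
    (W.baseChange ℚ_[p]).isUnit_Δ.ne_zero

/-- **Split multiplicative reduction at `p`, read on the global minimal equation**:
`W.HasSplitMultiplicativeReductionAtPrime p ↔ (W ⊗ ℚ_p).HasSplitMultiplicativeReduction ℤ_[p]`
(tree `hasSplitMultiplicativeReductionAtPrime_iff_of_baseChange_eq_smul` with `C = 1`).
[cite: SilvermanAEC2009, VII.1 Prop. 1.3(b) and VII.5 Prop. 5.1(b) (PDF pp. 165–166, 174)] -/
theorem hasSplitMultiplicativeReductionAtPrime_iff_baseChange_padic :
    W.HasSplitMultiplicativeReductionAtPrime p ↔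
      (W.baseChange ℚ_[p]).HasSplitMultiplicativeReduction ℤ_[p] :=
  hasSplitMultiplicativeReductionAtPrime_iff_of_baseChange_eq_smul
    (X := W.baseChange ℚ_[p]) (C := (1 : VariableChange ℚ_[p])) (one_smul _ _).symm
    (W.baseChange ℚ_[p]).isUnit_Δ.ne_zero

omit [W.IsElliptic] [W.IsGloballyMinimal] in
/-- `(W ⊗ ℚ_p) ⊗ ℚ_p = W ⊗ ℚ_p` (the dictionary's `X ⊗ F` for `X = W ⊗ ℚ_p`, `F = ℚ_p`). [folklore] -/
theorem baseChange_padic_baseChange_self :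
    (W.baseChange ℚ_[p]).baseChange ℚ_[p] = W.baseChange ℚ_[p] := by
  rw [WeierstrassCurve.baseChange, Algebra.algebraMap_self, WeierstrassCurve.map_id]

omit [W.IsElliptic] in
/-- `(W ⊗ ℚ_p) ⊗ ℚ_p` is `ℤ_p`-minimal (the dictionary's instance `[(X.baseChange F).IsMinimal R₀]`
for `X = W ⊗ ℚ_p`; p1's `isMinimal_baseChange_padic` respelled). [cite: SilvermanAEC2009, VIII.8] -/
theorem isMinimal_baseChange_padic_self :
    ((W.baseChange ℚ_[p]).baseChange ℚ_[p]).IsMinimal ℤ_[p] := by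
  rw [baseChange_padic_baseChange_self]; infer_instance

/-- `W.HasMultiplicativeReductionAtPrime p` in the dictionary's spelling over `R₀ = ℤ_[p]`.
[folklore] -/
theorem hasMultiplicativeReduction_baseChange_padic_self
    (h : W.HasMultiplicativeReductionAtPrime p) :
    ((W.baseChange ℚ_[p]).baseChange ℚ_[p]).HasMultiplicativeReduction ℤ_[p] := by
  rw [baseChange_padic_baseChange_self]
  exact (hasMultiplicativeReductionAtPrime_iff_baseChange_padic W p).mp h

/-- `W.HasSplitMultiplicativeReductionAtPrime p` in the dictionary's spelling over `R₀ = ℤ_[p]`.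
[folklore] -/
theorem hasSplitMultiplicativeReduction_baseChange_padic_self
    (h : W.HasSplitMultiplicativeReductionAtPrime p) :
    ((W.baseChange ℚ_[p]).baseChange ℚ_[p]).HasSplitMultiplicativeReduction ℤ_[p] := by
  rw [baseChange_padic_baseChange_self]
  exact (hasSplitMultiplicativeReductionAtPrime_iff_baseChange_padic W p).mp h

/-! ### §2 Over a layer `L ⊇ ℚ_p` with valuation ring `R`, `ℤ_p → R` local -/

variable (L : Type) [Field L] [Algebra ℚ_[p] L]
  (R : Type*) [CommRing R] [IsDomain R] [IsDiscreteValuationRing R] [Algebra R L]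
  [IsFractionRing R L] [Algebra ℤ_[p] R] [Algebra ℤ_[p] L] [IsScalarTower ℤ_[p] R L]
  [IsScalarTower ℤ_[p] ℚ_[p] L] [IsLocalHom (algebraMap ℤ_[p] R)]

/-- **Multiplicative reduction at `p` survives every layer `L ⊇ ℚ_p` with `ℤ_p → R` local**
(e.g. `L = K[c]_w`): `(W ⊗ ℚ_p) ⊗ L` is `R`-minimal with multiplicative reduction (p4's
`hasMultiplicativeReduction_baseChange`, *AEC* VII.5.4 (b)).
[cite: SilvermanAEC2009, Prop. VII.5.4 (b) (PDF p. 175)] -/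
theorem hasMultiplicativeReduction_baseChange_padic (h : W.HasMultiplicativeReductionAtPrime p) :
    ((W.baseChange ℚ_[p]).baseChange L).HasMultiplicativeReduction R := by
  haveI := hasMultiplicativeReduction_baseChange_padic_self W p h
  exact hasMultiplicativeReduction_baseChange (W.baseChange ℚ_[p]) L ℤ_[p] R

/-- **Split multiplicative reduction at `p` survives every layer `L ⊇ ℚ_p` with `ℤ_p → R`
local**: `(W ⊗ ℚ_p) ⊗ L` has split multiplicative reduction over `R` (p255042 §3).
[cite: SilvermanAEC2009, Prop. VII.5.4 (b) (PDF p. 175), VII.§5] -/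
theorem hasSplitMultiplicativeReduction_baseChange_padic
    (h : W.HasSplitMultiplicativeReductionAtPrime p) :
    ((W.baseChange ℚ_[p]).baseChange L).HasSplitMultiplicativeReduction R := by
  haveI := hasSplitMultiplicativeReduction_baseChange_padic_self W p h
  exact hasSplitMultiplicativeReduction_baseChange (W.baseChange ℚ_[p]) L ℤ_[p] R

/-- **Node presentation for `E/ℚ` SPLIT multiplicative at `p`, over a layer `L ⊇ ℚ_p`** with
finite residue field: the `R`-model `W₀` of `(W ⊗ ℚ_p) ⊗ L` reduces to
`singularModel x₀ y₀ α₁ α₂`, `α₁ ≠ α₂`, over the residue field of `R` — p4's `hW`, `hα`.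
[cite: SilvermanAEC2009, VII.§5 (PDF p. 174), Prop. III.1.4(a)] -/
theorem exists_map_residue_eq_singularModel_padic [Finite (IsLocalRing.ResidueField R)]
    (h : W.HasSplitMultiplicativeReductionAtPrime p) (W₀ : WeierstrassCurve R)
    (hX : (W.baseChange ℚ_[p]).baseChange L = W₀.baseChange L) :
    ∃ x₀ y₀ α₁ α₂ : IsLocalRing.ResidueField R, α₁ ≠ α₂ ∧
      W₀.map (IsLocalRing.residue R) = singularModel x₀ y₀ α₁ α₂ := by
  haveI := hasSplitMultiplicativeReduction_baseChange_padic W p L R h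
  exact exists_map_residue_eq_singularModel_of_hasSplitMultiplicativeReduction
    (W.baseChange ℚ_[p]) L R W₀ hX

/-- **Node presentation for `E/ℚ` MULTIPLICATIVE at `p` (split or not), over a layer `L ⊇ ℚ_p`
and an extension `k'` of the residue field of `R` containing a root of Mathlib's splitting
quadratic** (the NON-SPLIT node's `k'`-form, S15 (ii)): `(W₀ mod 𝔪) ⊗ k' = singularModel (j x₀)
(j y₀) α₁ α₂`, `x₀, y₀` rational over the residue field, `α₁ ≠ α₂ ∈ k'`.
[cite: SilvermanAEC2009, VII.§5 (PDF p. 174), Prop. III.1.4(a)] -/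
theorem exists_map_map_residue_eq_singularModel_padic [Finite (IsLocalRing.ResidueField R)]
    (h : W.HasMultiplicativeReductionAtPrime p) (W₀ : WeierstrassCurve R)
    (hX : (W.baseChange ℚ_[p]).baseChange L = W₀.baseChange L)
    {k' : Type*} [Field k'] (j : IsLocalRing.ResidueField R →+* k') {α : k'}
    (hroot : (((Polynomial.C W₀.c₄ * Polynomial.X ^ 2 + Polynomial.C (W₀.a₁ * W₀.c₄) * Polynomial.X -
        Polynomial.C (54 * W₀.b₆ - 3 * W₀.b₂ * W₀.b₄ + W₀.a₂ * W₀.c₄)).map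
          (algebraMap R (IsLocalRing.ResidueField R))).map j).IsRoot α) :
    ∃ x₀ y₀ : IsLocalRing.ResidueField R, ∃ α₁ α₂ : k', α₁ ≠ α₂ ∧
      (W₀.map (IsLocalRing.residue R)).map j = singularModel (j x₀) (j y₀) α₁ α₂ := by
  haveI := hasMultiplicativeReduction_baseChange_padic W p L R h
  exact exists_map_map_residue_eq_singularModel_of_hasMultiplicativeReduction
    (W.baseChange ℚ_[p]) L R W₀ hX j hroot

/-- **Jetchev's Prop. 4.1 at `v ∣ p`, end form, for `E/ℚ` with SPLIT multiplicative reduction at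
`p`**, over a Galois layer `L ⊇ ℚ_p` with valuation ring `R` (`ℤ_p → R` local, `R` henselian,
finite residue field of `qⁿ` elements, `Aut(L/ℚ_p) = ⟨φ⟩`, `φⁿ = 1`, `φ` lifting `x ↦ x^q`, every
`τ` preserving `R`): given p1's inputs (a) `hT`, (b) `hP`/`hRσ`, the cocycle `hU`/`hpU` and the
ONE remaining stub `h1ker` (formal-group half of (α), Milne *ADT* I.3.8 proof),
`T = ι(t₀ + p^m t₁)` with `t₀ ∈ E₀(ℚ_p)`. Node presentation, minimality and Galois stability of
`E₀` are DISCHARGED (p255042, p4's p252692/p252933/p253944); the two `IsMinimal` instances in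
the binder list are `isMinimal_baseChange_padic_self` / `(hasSplitMultiplicativeReduction_baseChange_padic …).toIsMinimal`
(needed to STATE `E₀`). [cite: Jetchev2008, Prop. 4.1 (p. 819)] [cite: MilneADT2006, Ch. I Prop. 3.8] -/
theorem exists_baseChange_eq_add_pow_smul_padic_of_h1ker [IsGalois ℚ_[p] L]
    [HenselianRing R (IsLocalRing.maximalIdeal R)] [Finite (IsLocalRing.ResidueField R)]
    [((W.baseChange ℚ_[p]).baseChange L).IsMinimal R]
    [((W.baseChange ℚ_[p]).baseChange ℚ_[p]).IsMinimal ℤ_[p]]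
    (h : W.HasSplitMultiplicativeReductionAtPrime p) (W₀ : WeierstrassCurve R)
    (hX : (W.baseChange ℚ_[p]).baseChange L = W₀.baseChange L)
    (hR : ∀ (τ : L ≃ₐ[ℚ_[p]] L) (x : L), x ∈ Set.range (algebraMap R L) →
      τ x ∈ Set.range (algebraMap R L))
    (φ : L ≃ₐ[ℚ_[p]] L) (hφ : ∀ σ : L ≃ₐ[ℚ_[p]] L, σ ∈ Subgroup.zpowers φ) {q n : ℕ}
    (hn : φ ^ n = 1) (hcard : Nat.card (IsLocalRing.ResidueField R) = q ^ n)
    (hfrob : ∀ a : R, ∃ a' : R, algebraMap R L a' = φ (algebraMap R L a) ∧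
      IsLocalRing.residue R a' = IsLocalRing.residue R a ^ q)
    (h1ker : ∀ m ∈ {Q : ((W.baseChange ℚ_[p]).baseChange L).toAffine.Point | ∀ (x y : L)
        (h : ((W.baseChange ℚ_[p]).baseChange L).toAffine.Nonsingular x y), Q = .some x y h →
          x ∉ Set.range (algebraMap R L)},
      ∑ j ∈ Finset.range n, (φ ^ j) • m = 0 →
        ∃ P ∈ {Q : ((W.baseChange ℚ_[p]).baseChange L).toAffine.Point | ∀ (x y : L)
          (h : ((W.baseChange ℚ_[p]).baseChange L).toAffine.Nonsingular x y), Q = .some x y h →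
            x ∉ Set.range (algebraMap R L)}, φ • P - P = m)
    {m n' : ℕ} (hcop : Nat.Coprime n' (p ^ m))
    {U P T : ((W.baseChange ℚ_[p]).baseChange L).toAffine.Point}
    {Rσ : (L ≃ₐ[ℚ_[p]] L) → ((W.baseChange ℚ_[p]).baseChange L).toAffine.Point}
    (hT : ∀ σ : L ≃ₐ[ℚ_[p]] L, σ • T = T)
    (hP : (n' : ℤ) • P ∈ ((W.baseChange ℚ_[p]).baseChange L).goodReductionSubgroup R)
    (hRσ : ∀ σ : L ≃ₐ[ℚ_[p]] L,
      (n' : ℤ) • Rσ σ ∈ ((W.baseChange ℚ_[p]).baseChange L).goodReductionSubgroup R)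
    (hU : ∀ σ : L ≃ₐ[ℚ_[p]] L, σ • U - U = Rσ σ) (hpU : ((p ^ m : ℕ) : ℤ) • U = P - T) :
    ∃ t₀ t₁ : ((W.baseChange ℚ_[p]).baseChange ℚ_[p]).toAffine.Point,
      t₀ ∈ ((W.baseChange ℚ_[p]).baseChange ℚ_[p]).goodReductionSubgroup ℤ_[p] ∧
      T = Affine.Point.baseChange (W' := (W.baseChange ℚ_[p]).toAffine) ℚ_[p] L
        (t₀ + ((p ^ m : ℕ) : ℤ) • t₁) := by
  haveI := hasSplitMultiplicativeReduction_baseChange_padic W p L R h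
  exact exists_baseChange_eq_add_pow_smul_of_h1ker_of_hasSplitMultiplicativeReduction
    (W.baseChange ℚ_[p]) L R W₀ hX ℤ_[p] hR φ hφ hn hcard hfrob h1ker hcop hT hP hRσ hU hpU

end Summit.BirchSwinnertonDyer.Rank1Residual.X11b.Three.JetchevKummer

end
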